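import Summits.CriticalPhenomena.CardyFormulaZ2.Theorems.CardyBoundaryCoulombGasRectilinearCardyStubEventIdentityPart7
import Summits.CriticalPhenomena.CardyFormulaZ2.Theorems.CardyBoundaryCoulombGasBoundaryDefectGaussianRS17ConfigsNonemptyPart7

/-!
# Stub `stub_eventIdentity` of line `excursion-kernel-covariance` (crux `RectilinearCardy`,
# stmt-CriticalPhenomena-5660) — Part 8: the two wired chains carry the levels `-1` and `-3`
# (layer L5 of the design `Lines/excursion-kernel-covariance-eventIdentity-design.md`, in level form)

Setting of Parts 6–7. Instead of the geometric locality of the pocket edges of the two wired chains,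
the event identity uses the PRESCRIBED LEVELS `vertH` of the jump collar (the engine line's Lemma C,
`openEdges_vertH_eq`: both endpoints of a frozen open edge carry the same level):

* `ei_ghost_levels` — the ghosts of the four junction darts carry `vertH g_A = vertH g_B = -1`,
  `vertH g_X = vertH g_C = -3` (`vertH_pocketCorner` at the pockets next to them);
* `ei_arc_level` — an arc vertex carries level `-1` and lies on the block `[iA, iB]` of the cycle,
  or level `-3` and is `X` or lies on the block `[iC, period)` (`pc_arc_level` with the block states);
* `ei_vertH_nextCorner_of_not_isTracked` — **along an untracked corner the level of the vertex does
  not change**: the turning rule either keeps the vertex or follows an open target, which at an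
  untracked corner is a frozen open edge (a live edge would put the corner at a vertex of `V`);
* `ei_vertH_iterate_of_not_isTracked` — hence along a stretch of untracked corners of an orbit the
  vertex level is constant.

All [folklore]; no new objects.
-/

namespace Summit.CriticalPhenomena.CardyFormulaZ2.Cruxes.RectilinearCardy.ExcursionKernelCovariance

open Finset Literature.Probability.LatticeModels Literature.Probability.LatticeModels.CollarLegModel
open Summit.CriticalPhenomena.CardyFormulaZ2.Cruxes.BoundaryDefectGaussianR.RainbowMonomialsInExcursionKernels

/-- `ofSite` turns corner units into lattice directions. [folklore] -/
theorem ei_ofSite_add_cornerUnit (x : Site 2) (k : Fin 4) : ofSite (x + cornerUnit k) = ofSite x + dir k := by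
  have hx : x = toSite (ofSite x) := by funext i; fin_cases i <;> simp [toSite, ofSite]
  conv_lhs => rw [hx, ← se_toSite_add_dir, ofSite_toSite]

section Levels

variable {ι : LegInsertionData} {V : Finset (ℤ × ℤ)} {d₀ : Dart} {iA iB iC : ℕ}
  (hadm : ι.IsAdmissible V)
  (hflat : ∀ x ∈ insert ι.sink ι.source, ∃ dvec : ℤ × ℤ,
      (dvec = (1, 0) ∨ dvec = (-1, 0) ∨ dvec = (0, 1) ∨ dvec = (0, -1)) ∧
      ∀ v : ℤ × ℤ, (v.1 - x.1) ^ 2 + (v.2 - x.2) ^ 2 ≤ ((ι.sinkLegs : ℤ) + 3) ^ 2 →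
        (v ∈ V ↔ 0 ≤ (v.1 - x.1) * dvec.1 + (v.2 - x.2) * dvec.2))
  (hchart : ∀ u ∈ V, ∀ k : Fin 4, u + dir k ∉ V → ∃ (K : Fin 4) (c₁ c₂ : ℤ),
      (∀ v : ℤ × ℤ, |v.1 - u.1| ≤ 3 → |v.2 - u.2| ≤ 3 →
        (v ∈ V ↔ c₂ ≤ v.1 * (dir (K + 1)).1 + v.2 * (dir (K + 1)).2)) ∨
      (∀ v : ℤ × ℤ, |v.1 - u.1| ≤ 3 → |v.2 - u.2| ≤ 3 →
        (v ∈ V ↔ c₁ ≤ v.1 * (dir K).1 + v.2 * (dir K).2 ∧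
          c₂ ≤ v.1 * (dir (K + 1)).1 + v.2 * (dir (K + 1)).2)) ∨
      (∀ v : ℤ × ℤ, |v.1 - u.1| ≤ 3 → |v.2 - u.2| ≤ 3 →
        (v ∈ V ↔ c₂ ≤ v.1 * (dir (K + 1)).1 + v.2 * (dir (K + 1)).2 ∨
          v.1 * (dir K).1 + v.2 * (dir K).2 ≤ c₁)))
  (hv₀ : d₀.1 ∈ V) (ht₀ : dartTip d₀ ∉ V) (hout : outDart V d₀.1 = some d₀)
  (h2 : 2 ≤ iA) (hAB : iA < iB) (hBC : iB < iC) (hCP : iC < period V d₀)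
  (hcA : ((neighbours ((dsucc V)^[iA] d₀).1).filter (fun y ↦ y ∉ V)).card = 1)
  (hcB : ((neighbours ((dsucc V)^[iB] d₀).1).filter (fun y ↦ y ∉ V)).card = 1)
  (hcC : ((neighbours ((dsucc V)^[iC] d₀).1).filter (fun y ↦ y ∉ V)).card = 1)
  (hsrc : ι.source = {((dsucc V)^[iA] d₀).1, ((dsucc V)^[iB] d₀).1, ((dsucc V)^[iC] d₀).1})
  (hlegs : ∀ x ∈ ι.source, ι.legs x = 1) (hsink : ι.sink = d₀.1) (hsl : ι.sinkLegs = 3)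

include hadm hflat hchart hv₀ ht₀ hout h2 hAB hBC hCP hcA hcB hcC hsrc hlegs hsink hsl in
/-- **The levels of the four junction ghosts**: `vertH g_A = vertH g_B = -1` (the level `-1` arc
opens at `A` and closes at `B`), `vertH g_X = vertH g_C = -3`. [folklore] -/
theorem ei_ghost_levels :
    (ι.collar V).vertH (dartTip ((dsucc V)^[iA] d₀)) = -1 ∧ (ι.collar V).vertH (dartTip ((dsucc V)^[iB] d₀)) = -1 ∧
      (ι.collar V).vertH (dartTip d₀) = -3 ∧ (ι.collar V).vertH (dartTip ((dsucc V)^[iC] d₀)) = -3 := by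
  obtain ⟨hs0, hs1, -, hsA, hsA1, hsB, hsB1, hsC, hsC1⟩ := ei_states hv₀ ht₀ hout h2 hAB hBC hCP hcA hcB hcC hsrc hlegs hsink hsl
  have h0 : outDart V ι.sink = some d₀ := by rw [hsink]; exact hout
  have hst : ∀ t, (fun t => List.foldl (fun s d => s.step (ι.startAt V d)) ι.init ((cycle V d₀).take t)) t = List.foldl (fun s d => s.step (ι.startAt V d)) ι.init ((cycle V d₀).take t) := fun _ => rfl
  have hlen : (cycle V d₀).length = period V d₀ := by simp [cycle]
  have hget : ∀ (t : ℕ) (ht : t < (cycle V d₀).length), (cycle V d₀)[t] = (dsucc V)^[t] d₀ := by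
    intro t ht; simp [cycle]
  have hext : ∀ i, ((dsucc V)^[i] d₀).1 ∈ V ∧ dartTip ((dsucc V)^[i] d₀) ∉ V :=
    fun i => (s3_dsucc_iterate V i).1 d₀ hv₀ ht₀
  obtain ⟨S, hS⟩ : ∃ S : ℕ → WalkState, ∀ t, S t = if t = 0 then ⟨-3, true, 0, 0⟩
      else if t = 1 then ⟨-2, false, 2, 1⟩ else if t ≤ iA then ⟨0, false, 0, 1⟩
      else if t ≤ iB then ⟨-1, true, 0, -1⟩ else if t ≤ iC then ⟨-2, false, 0, -1⟩
      else ⟨-3, true, 0, -1⟩ := ⟨_, fun t => rfl⟩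
  have hW := ei_walk_state hv₀ ht₀ hout h2 hAB hBC hCP hcA hcB hcC hsrc hlegs hsink hsl hS
  refine ⟨?_, ?_, ?_, ?_⟩
  · -- `g_A`: corner of the pocket after the dart `iA`
    have ht : iA < (cycle V d₀).length := by rw [hlen]; omega
    have hx : dartTip ((dsucc V)^[iA] d₀) ∈ SixVertex.faceCorners (gapFace (cycle V d₀)[iA]) := by
      rw [hget iA ht]
      exact (mem_faceCorners_gapFace _ _ _).2 (Or.inr (Or.inl rfl))
    have := vertH_pocketCorner ι V hadm h0 hst hflat hchart ht (by rw [hsA1]) hx (hext iA).2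
    rw [hsA, hsA1] at this
    simpa using this
  · -- `g_B`: far corner of the pocket after the dart `iB - 1`
    obtain ⟨htB, -, -, -, hpB, -⟩ := ei_rail hadm hflat hout hsink (t := iB) (by omega)
      (by rw [hsB1, hsB]; decide)
    have ht : iB - 1 < (cycle V d₀).length := by omega
    have hiB : iB - 1 + 1 = iB := by omega
    have hx : dartTip ((dsucc V)^[iB] d₀) ∈ SixVertex.faceCorners (gapFace (cycle V d₀)[iB - 1]) := by
      rw [hpB (by omega)]
      exact (mem_faceCorners_gapFace _ _ _).2 (Or.inr (Or.inr (Or.inr (by rw [dartTip]; abel))))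
    have := vertH_pocketCorner ι V hadm h0 hst hflat hchart ht (by rw [hiB, hsB]) hx (hext iB).2
    by_cases hle : iB - 1 ≤ iA
    · have hSj : S (iB - 1) = ⟨0, false, 0, 1⟩ := by
        rw [hS, if_neg (by omega), if_neg (by omega), if_pos hle]
      rw [hiB, hsB, hW (iB - 1) (by omega), hSj] at this
      simpa using this
    · have hSj : S (iB - 1) = ⟨-1, true, 0, -1⟩ := by
        rw [hS, if_neg (by omega), if_neg (by omega), if_neg hle, if_pos (by omega)]
      rw [hiB, hsB, hW (iB - 1) (by omega), hSj] at this
      simpa using this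
  · -- `g_X`: far corner of the pocket after the last dart of the cycle
    obtain ⟨hl0, -, -, -, -, hq0⟩ := ei_rail hadm hflat hout hsink (t := 0) (by omega)
      (by rw [hs1, hs0]; decide)
    have ht : (cycle V d₀).length - 1 < (cycle V d₀).length := by omega
    have hP : (cycle V d₀).length - 1 + 1 = period V d₀ := by rw [hlen]; omega
    have hx : dartTip d₀ ∈ SixVertex.faceCorners (gapFace (cycle V d₀)[(cycle V d₀).length - 1]) := by
      rw [hq0 rfl]
      exact (mem_faceCorners_gapFace _ _ _).2 (Or.inr (Or.inr (Or.inr (by rw [dartTip]; abel))))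
    have hSP : S (period V d₀) = ⟨-3, true, 0, -1⟩ := by
      rw [hS, if_neg (by omega), if_neg (by omega), if_neg (by omega), if_neg (by omega), if_neg (by omega)]
    have := vertH_pocketCorner ι V hadm h0 hst hflat hchart ht (by rw [hP, hW _ le_rfl, hSP]) hx ht₀
    have hQ : (cycle V d₀).length - 1 ≤ period V d₀ := by rw [hlen]; omega
    by_cases hle : (cycle V d₀).length - 1 ≤ iC
    · have hSj : S ((cycle V d₀).length - 1) = ⟨-2, false, 0, -1⟩ := by
        rw [hS, if_neg (by omega), if_neg (by omega), if_neg (by omega), if_neg (by omega), if_pos hle]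
      rw [hP, hW _ le_rfl, hSP, hW _ hQ, hSj] at this
      simpa using this
    · have hSj : S ((cycle V d₀).length - 1) = ⟨-3, true, 0, -1⟩ := by
        rw [hS, if_neg (by omega), if_neg (by omega), if_neg (by omega), if_neg (by omega), if_neg hle]
      rw [hP, hW _ le_rfl, hSP, hW _ hQ, hSj] at this
      simpa using this
  · -- `g_C`: corner of the pocket after the dart `iC`
    have ht : iC < (cycle V d₀).length := by rw [hlen]; omega
    have hx : dartTip ((dsucc V)^[iC] d₀) ∈ SixVertex.faceCorners (gapFace (cycle V d₀)[iC]) := by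
      rw [hget iC ht]
      exact (mem_faceCorners_gapFace _ _ _).2 (Or.inr (Or.inl rfl))
    have := vertH_pocketCorner ι V hadm h0 hst hflat hchart ht (by rw [hsC1]) hx (hext iC).2
    rw [hsC, hsC1] at this
    simpa using this

include hadm hflat hchart hv₀ ht₀ hout h2 hAB hBC hCP hcA hcB hcC hsrc hlegs hsink hsl in
/-- **The level of an arc vertex tells its chain**: an arc vertex carries `vertH = -1` and is a
vertex of the block `[iA, iB]` of the cycle, or `vertH = -3` and is `X` or a vertex of the block
`[iC, period)`. [folklore] -/
theorem ei_arc_level {a : ℤ × ℤ} (ha : a ∈ (ι.model V).arcVerts) :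
    ((ι.collar V).vertH a = -1 ∧ ∃ s, iA ≤ s ∧ s ≤ iB ∧ ((dsucc V)^[s] d₀).1 = a) ∨
    ((ι.collar V).vertH a = -3 ∧ (a = d₀.1 ∨ ∃ s, iC ≤ s ∧ s < period V d₀ ∧ ((dsucc V)^[s] d₀).1 = a)) := by
  have h0 : outDart V ι.sink = some d₀ := by rw [hsink]; exact hout
  have hst : ∀ t, (fun t => List.foldl (fun s d => s.step (ι.startAt V d)) ι.init ((cycle V d₀).take t)) t = List.foldl (fun s d => s.step (ι.startAt V d)) ι.init ((cycle V d₀).take t) := fun _ => rfl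
  have hlen : (cycle V d₀).length = period V d₀ := by simp [cycle]
  have hget : ∀ (t : ℕ) (ht : t < (cycle V d₀).length), (cycle V d₀)[t] = (dsucc V)^[t] d₀ := by
    intro t ht; simp [cycle]
  obtain ⟨S, hS⟩ : ∃ S : ℕ → WalkState, ∀ t, S t = if t = 0 then ⟨-3, true, 0, 0⟩
      else if t = 1 then ⟨-2, false, 2, 1⟩ else if t ≤ iA then ⟨0, false, 0, 1⟩
      else if t ≤ iB then ⟨-1, true, 0, -1⟩ else if t ≤ iC then ⟨-2, false, 0, -1⟩
      else ⟨-3, true, 0, -1⟩ := ⟨_, fun t => rfl⟩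
  have hW := ei_walk_state hv₀ ht₀ hout h2 hAB hBC hCP hcA hcB hcC hsrc hlegs hsink hsl hS
  have key : ∀ t, (S t).wired = true →
      ((t = 0 ∨ iC < t) ∧ (S t).level = -3) ∨ (iA < t ∧ t ≤ iB ∧ (S t).level = -1) := by
    intro t hw
    rw [hS t] at hw ⊢
    split_ifs at hw ⊢ with h₀ h₁ h₂ h₃ h₄ <;> simp at hw ⊢ <;> omega
  have harc : a ∈ (ι.collar V).arc := (Finset.mem_inter.1 ha).1
  obtain ⟨t, ht, hta, hlev⟩ := pc_arc_level ι V hadm h0 hst hflat hchart harc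
  rw [hget t ht] at hta
  have htP : t < period V d₀ := hlen ▸ ht
  rcases hlev with ⟨hw, hv⟩ | ⟨hw, hv⟩
  · rw [hW t htP.le] at hw hv
    rcases key t hw with ⟨ht0, hl⟩ | ⟨h1, h2, hl⟩
    · right
      refine ⟨hv.trans hl, ?_⟩
      rcases ht0 with rfl | hCt
      · exact Or.inl hta.symm
      · exact Or.inr ⟨t, hCt.le, htP, hta⟩
    · exact Or.inl ⟨hv.trans hl, t, h1.le, h2, hta⟩
  · rw [hW (t + 1) (by omega)] at hw hv
    rcases key (t + 1) hw with ⟨ht0, hl⟩ | ⟨h1, h2, hl⟩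
    · right
      refine ⟨hv.trans hl, Or.inr ⟨t, by omega, htP, hta⟩⟩
    · exact Or.inl ⟨hv.trans hl, t, by omega, by omega, hta⟩

include hadm hflat hchart in
/-- **The vertex level does not change along an untracked corner.** For `ω ⊆ E` and an untracked
corner `c`, the vertex of `nextCorner (cfgOf ω) c` carries the same prescribed level as the vertex
of `c`: across a closed target the vertex is kept; an open target at an untracked corner is a frozen
open edge (a live one has both endpoints in `V`, whose corners are tracked), along which `vertH` is
constant (`openEdges_vertH_eq`). [folklore] -/
theorem ei_vertH_nextCorner_of_not_isTracked {ω : Finset ((ℤ × ℤ) × Bool)} (hω : ω ⊆ (ι.model V).E)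
    {c : Site 2 × Fin 4} (hc : ¬(ι.model V).IsTracked c) :
    (ι.collar V).vertH (ofSite (nextCorner ((ι.model V).cfgOf ω) c).1) = (ι.collar V).vertH (ofSite c.1) := by
  by_cases hb : cTgt c ∈ (ι.model V).cfgOf ω
  · rw [nextCorner_of_mem hb]
    simp only
    rw [ei_ofSite_add_cornerUnit]
    obtain ⟨e, hce, hend⟩ := se_corner_edge (ofSite c.1) c.2
    rw [ei_corner_eq c] at hb
    rcases (se_cTgt_mem_cfgOf_iff (ι.model V) ω hce).1 hb with he | he
    · -- a live target: the corner sits at a vertex of `V`, hence is tracked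
      exfalso
      have hE := hω he
      rw [E, inducedEdges, mem_filter] at hE
      apply hc
      apply perCfg_isTracked_of_mem_V
      rcases hend with ⟨h1, -⟩ | ⟨-, h2⟩
      · rw [← h1]; exact hE.2.1
      · rw [← h2]; exact hE.2.2
    · have hlev : (ι.collar V).vertH e.1 = (ι.collar V).vertH (SixVertex.edgeTip e) :=
        openEdges_vertH_eq ι V hadm hflat hchart he
      rcases hend with ⟨h1, h2⟩ | ⟨h1, h2⟩
      · rw [h1, h2] at hlev; exact hlev.symm
      · rw [h1, h2] at hlev; exact hlev
  · rw [nextCorner_of_not_mem hb]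

include hadm hflat hchart in
/-- **Along a stretch of untracked corners the vertex level is constant.** [folklore] -/
theorem ei_vertH_iterate_of_not_isTracked {ω : Finset ((ℤ × ℤ) × Bool)} (hω : ω ⊆ (ι.model V).E)
    {c : Site 2 × Fin 4} {n : ℕ} (hn : ∀ m < n, ¬(ι.model V).IsTracked ((nextCorner ((ι.model V).cfgOf ω))^[m] c)) :
    (ι.collar V).vertH (ofSite ((nextCorner ((ι.model V).cfgOf ω))^[n] c).1) = (ι.collar V).vertH (ofSite c.1) := by
  induction n with
  | zero => rfl
  | succ n ih =>
    rw [Function.iterate_succ_apply',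
      ei_vertH_nextCorner_of_not_isTracked hadm hflat hchart hω (hn n (Nat.lt_succ_self n))]
    exact ih fun m hm => hn m (Nat.lt_succ_of_lt hm)

end Levels

/-- **Registered form of `ei_ghost_levels`** (landing anchor, all hypotheses explicit). [folklore] -/
theorem ei_ghost_levels_explicit {ι : LegInsertionData} {V : Finset (ℤ × ℤ)} {d₀ : Dart} {iA iB iC : ℕ}
    (hadm : ι.IsAdmissible V)
    (hflat : ∀ x ∈ insert ι.sink ι.source, ∃ dvec : ℤ × ℤ,
      (dvec = (1, 0) ∨ dvec = (-1, 0) ∨ dvec = (0, 1) ∨ dvec = (0, -1)) ∧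
      ∀ v : ℤ × ℤ, (v.1 - x.1) ^ 2 + (v.2 - x.2) ^ 2 ≤ ((ι.sinkLegs : ℤ) + 3) ^ 2 →
        (v ∈ V ↔ 0 ≤ (v.1 - x.1) * dvec.1 + (v.2 - x.2) * dvec.2))
    (hchart : ∀ u ∈ V, ∀ k : Fin 4, u + dir k ∉ V → ∃ (K : Fin 4) (c₁ c₂ : ℤ),
      (∀ v : ℤ × ℤ, |v.1 - u.1| ≤ 3 → |v.2 - u.2| ≤ 3 →
        (v ∈ V ↔ c₂ ≤ v.1 * (dir (K + 1)).1 + v.2 * (dir (K + 1)).2)) ∨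
      (∀ v : ℤ × ℤ, |v.1 - u.1| ≤ 3 → |v.2 - u.2| ≤ 3 →
        (v ∈ V ↔ c₁ ≤ v.1 * (dir K).1 + v.2 * (dir K).2 ∧
          c₂ ≤ v.1 * (dir (K + 1)).1 + v.2 * (dir (K + 1)).2)) ∨
      (∀ v : ℤ × ℤ, |v.1 - u.1| ≤ 3 → |v.2 - u.2| ≤ 3 →
        (v ∈ V ↔ c₂ ≤ v.1 * (dir (K + 1)).1 + v.2 * (dir (K + 1)).2 ∨
          v.1 * (dir K).1 + v.2 * (dir K).2 ≤ c₁)))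
    (hv₀ : d₀.1 ∈ V) (ht₀ : dartTip d₀ ∉ V) (hout : outDart V d₀.1 = some d₀)
  (h2 : 2 ≤ iA) (hAB : iA < iB) (hBC : iB < iC) (hCP : iC < period V d₀)
  (hcA : ((neighbours ((dsucc V)^[iA] d₀).1).filter (fun y ↦ y ∉ V)).card = 1)
  (hcB : ((neighbours ((dsucc V)^[iB] d₀).1).filter (fun y ↦ y ∉ V)).card = 1)
  (hcC : ((neighbours ((dsucc V)^[iC] d₀).1).filter (fun y ↦ y ∉ V)).card = 1)
  (hsrc : ι.source = {((dsucc V)^[iA] d₀).1, ((dsucc V)^[iB] d₀).1, ((dsucc V)^[iC] d₀).1})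
  (hlegs : ∀ x ∈ ι.source, ι.legs x = 1) (hsink : ι.sink = d₀.1) (hsl : ι.sinkLegs = 3) :
    (ι.collar V).vertH (dartTip ((dsucc V)^[iA] d₀)) = -1 ∧ (ι.collar V).vertH (dartTip ((dsucc V)^[iB] d₀)) = -1 ∧
      (ι.collar V).vertH (dartTip d₀) = -3 ∧ (ι.collar V).vertH (dartTip ((dsucc V)^[iC] d₀)) = -3 :=
  ei_ghost_levels hadm hflat hchart hv₀ ht₀ hout h2 hAB hBC hCP hcA hcB hcC hsrc hlegs hsink hsl

end Summit.CriticalPhenomena.CardyFormulaZ2.Cruxes.RectilinearCardy.ExcursionKernelCovariance
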